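import Literature.NumberTheory.GaloisRepresentations.IdeleTruncatedS
import HarnessLib

/-!
# Truncation at `S`: `x ↦ x^{(S)}` (keep the components above `S` and at infinity, put `1` elsewhere), the
# splitting `ideleS = truncIdeles · unitIdelesOff` of Tate's `S`-idèles, and `J_{E,S}` as a `Gal(E/F)`-module
# (Harari, *Galois Cohomology and CFT*, Lemma 15.39 (proof), §17.4 (17.1))

Topic `NumberTheory/GaloisRepresentations`; namespace `Literature.NumberTheory.GaloisRepresentations.IdeleHerbrand`, a
sequel to `IdeleTruncatedS.lean` (`truncIdeles F E S` = Harari's `J_{E,S}`, the idèles trivial off `S`).  Definitions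
with bodies and theorems; NO named fact, no `sorry`, no instance, no notation; number fields in `Type`.

THE POINT.  Harari's exact sequence (17.1) `0 → E_S → I_S → C_S → 0` embeds the `S`-units into the TRUNCATED idèles
by `a ↦ (a)_{w ∣ S ∪ ∞} × (1)_{w ∤ S}` [Lemma 15.39, proof: "`J_{F,S} ∩ (F^* · U_{F,S}) = i(𝒪_{F,S}^*)`"], i.e. by the
diagonal embedding followed by the TRUNCATION `x ↦ x^{(S)}`; and Tate's `S`-idèles (local units off `S`, the tree's
`IdeleCohomology.ideleS`) split as `J_{E,S}^{Tate} = J_{E,S} · U_{E,S}` with `J_{E,S} ∩ U_{E,S} = 1`, the truncation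
being the projection onto the first factor with kernel `U_{E,S}` on `ideleS`.  This file constructs the truncation as a
`Gal(E/F)`-equivariant monoid endomorphism of `J_E` and proves the splitting.

## What is formalised (`F E : Type` number fields, `S : Finset (HeightOneSpectrum (𝓞 F))`, `x y : ideleGroup E`)

* §1 `truncOf S x : ideleGroup E` (`x^{(S)}`), `truncOf_fst` / `truncOf_snd_apply` (components, `rfl`), `truncOf_mem`
  (`x^{(S)} ∈ J_{E,S}`), `truncOf_one`, `truncOf_mul`, **`truncMonoidHom F E S : ideleGroup E →* ideleGroup E`**,
  `truncOf_eq_self` (identity on `J_{E,S}`), **`truncOf_smul`** (`Gal(E/F)`-equivariance).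
* §2 **`mul_truncOf_inv_mem_unitIdelesOff`** (`x ∈ ideleS ⇒ x · (x^{(S)})⁻¹ ∈ U_{E,S}`),
  **`truncIdeles_sup_unitIdelesOff : truncIdeles F E S ⊔ unitIdelesOff F E S = ideleS F E S`**,
  `truncOf_eq_one_of_mem_unitIdelesOff` (`U_{E,S}` is killed).
* §3 `truncRepr` / **`truncRep F E S : Rep ℤ Gal(E/F)`** (`J_{E,S}` as a `G`-module, `Herbrand.stableRepr`),
  `coe_toMul_truncRep_ρ`, **`truncRepHom S : IdeleCohomology.ideleSRep F E S ⟶ truncRep F E S`** (the truncation as a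
  morphism of representations) and `coe_toMul_truncRepHom_apply`.

Written for lane «PT-Ш-S-TC» (brick D3) of crux `GoodLatticeBDPValue` (cell bsd-eis, item 19032), seat bsd-line-x1-p1-w6
gen 10.  HONEST FRAMING: idèle bookkeeping; no arithmetic statement and no case of BSD is proved here.

## References
* D. Harari, *Galois Cohomology and Class Field Theory*, Universitext, Springer (2020), Def. 15.38, Lemma 15.39,
  §17.4 (17.1). [Harari2020]
* J. W. S. Cassels, A. Fröhlich (eds.), *Algebraic Number Theory* (1967), Ch. VII (J. Tate) §7.3. [CasselsFrohlichANT1967]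
-/

noncomputable section

open NumberField IsDedekindDomain
open Literature.NumberTheory.Automorphic
open scoped Classical

namespace Literature.NumberTheory.GaloisRepresentations

namespace IdeleHerbrand

variable {F : Type} [Field F] [NumberField F] {E : Type} [Field E] [NumberField E] [Algebra F E]
variable (S : Finset (HeightOneSpectrum (𝓞 F)))

/-! ## §1. The truncation `x ↦ x^{(S)}` -/

/-- **The truncation `x^{(S)}` of an idèle at `S`**: infinite part and components above `S` those of `x`, components
off `S` equal to `1`. [cite: Harari2020, Lemma 15.39 (proof)] -/
def truncOf (x : ideleGroup E) : ideleGroup E where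
  val := ((x : AdeleRing (𝓞 E) E).1, RestrictedProduct.mk
    (fun w => if w.under (𝓞 F) ∈ S then (x : AdeleRing (𝓞 E) E).2 w else 1)
    (((x : AdeleRing (𝓞 E) E).2).2.mono fun w hw => by
      by_cases h : w.under (𝓞 F) ∈ S
      · simp only [h, ↓reduceIte]; exact hw
      · simp only [h, ↓reduceIte]; exact one_mem _))
  inv := (((x⁻¹ : ideleGroup E) : AdeleRing (𝓞 E) E).1, RestrictedProduct.mk
    (fun w => if w.under (𝓞 F) ∈ S then ((x⁻¹ : ideleGroup E) : AdeleRing (𝓞 E) E).2 w else 1)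
    ((((x⁻¹ : ideleGroup E) : AdeleRing (𝓞 E) E).2).2.mono fun w hw => by
      by_cases h : w.under (𝓞 F) ∈ S
      · simp only [h, ↓reduceIte]; exact hw
      · simp only [h, ↓reduceIte]; exact one_mem _))
  val_inv := by
    refine Prod.ext ?_ (FiniteAdeleRing.ext E fun w => ?_)
    · show (x : AdeleRing (𝓞 E) E).1 * ((x⁻¹ : ideleGroup E) : AdeleRing (𝓞 E) E).1 = 1
      rw [← ideleGroup_val_fst_mul, mul_inv_cancel]; rfl
    show (if w.under (𝓞 F) ∈ S then (x : AdeleRing (𝓞 E) E).2 w else 1) *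
      (if w.under (𝓞 F) ∈ S then ((x⁻¹ : ideleGroup E) : AdeleRing (𝓞 E) E).2 w else 1) = 1
    by_cases h : w.under (𝓞 F) ∈ S
    · rw [if_pos h, if_pos h, snd_inv_apply, mul_inv_cancel₀ (snd_apply_ne_zero x w)]
    · rw [if_neg h, if_neg h, mul_one]
  inv_val := by
    refine Prod.ext ?_ (FiniteAdeleRing.ext E fun w => ?_)
    · show ((x⁻¹ : ideleGroup E) : AdeleRing (𝓞 E) E).1 * (x : AdeleRing (𝓞 E) E).1 = 1
      rw [← ideleGroup_val_fst_mul, inv_mul_cancel]; rfl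
    show (if w.under (𝓞 F) ∈ S then ((x⁻¹ : ideleGroup E) : AdeleRing (𝓞 E) E).2 w else 1) *
      (if w.under (𝓞 F) ∈ S then (x : AdeleRing (𝓞 E) E).2 w else 1) = 1
    by_cases h : w.under (𝓞 F) ∈ S
    · rw [if_pos h, if_pos h, snd_inv_apply, inv_mul_cancel₀ (snd_apply_ne_zero x w)]
    · rw [if_neg h, if_neg h, mul_one]

omit [NumberField F] in
/-- Infinite part of `x^{(S)}`: that of `x`. [cite: Harari2020, Lemma 15.39 (proof)] -/
@[simp] theorem truncOf_fst (x : ideleGroup E) :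
    ((truncOf S x : ideleGroup E) : AdeleRing (𝓞 E) E).1 = (x : AdeleRing (𝓞 E) E).1 := rfl

omit [NumberField F] in
/-- Finite components of `x^{(S)}`. [cite: Harari2020, Lemma 15.39 (proof)] -/
theorem truncOf_snd_apply (x : ideleGroup E) (w : HeightOneSpectrum (𝓞 E)) :
    ((truncOf S x : ideleGroup E) : AdeleRing (𝓞 E) E).2 w =
      if w.under (𝓞 F) ∈ S then (x : AdeleRing (𝓞 E) E).2 w else 1 := rfl

omit [NumberField F] in
/-- Inverse components of `x^{(S)}` (by construction those of `(x⁻¹)^{(S)}`). [cite: Harari2020, Lemma 15.39 (proof)] -/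
theorem truncOf_inv_snd_apply (x : ideleGroup E) (w : HeightOneSpectrum (𝓞 E)) :
    (((truncOf S x)⁻¹ : ideleGroup E) : AdeleRing (𝓞 E) E).2 w =
      if w.under (𝓞 F) ∈ S then ((x⁻¹ : ideleGroup E) : AdeleRing (𝓞 E) E).2 w else 1 := rfl

omit [NumberField F] in
/-- Inverse infinite part of `x^{(S)}`. [cite: Harari2020, Lemma 15.39 (proof)] -/
theorem truncOf_inv_fst (x : ideleGroup E) :
    (((truncOf S x)⁻¹ : ideleGroup E) : AdeleRing (𝓞 E) E).1 = ((x⁻¹ : ideleGroup E) : AdeleRing (𝓞 E) E).1 := rfl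

omit [NumberField F] in
/-- **`x^{(S)} ∈ J_{E,S}`.** [cite: Harari2020, Lemma 15.39 (proof)] -/
theorem truncOf_mem (x : ideleGroup E) : truncOf S x ∈ truncIdeles F E S := fun w hw => by
  rw [truncOf_snd_apply, if_neg hw]

omit [NumberField F] in
/-- `1^{(S)} = 1`. [cite: Harari2020, Lemma 15.39 (proof)] -/
theorem truncOf_one : truncOf S (1 : ideleGroup E) = 1 := by
  apply Units.ext
  refine Prod.ext rfl (FiniteAdeleRing.ext E fun w => ?_)
  rw [truncOf_snd_apply]
  split_ifs <;> rfl

omit [NumberField F] in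
/-- `(xy)^{(S)} = x^{(S)} y^{(S)}`. [cite: Harari2020, Lemma 15.39 (proof)] -/
theorem truncOf_mul (x y : ideleGroup E) : truncOf S (x * y) = truncOf S x * truncOf S y := by
  apply Units.ext
  refine Prod.ext ?_ (FiniteAdeleRing.ext E fun w => ?_)
  · rw [truncOf_fst, ideleGroup_val_fst_mul, ideleGroup_val_fst_mul, truncOf_fst, truncOf_fst]
  · rw [truncOf_snd_apply, snd_mul_apply, snd_mul_apply, truncOf_snd_apply, truncOf_snd_apply]
    by_cases h : w.under (𝓞 F) ∈ S
    · rw [if_pos h, if_pos h, if_pos h]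
    · rw [if_neg h, if_neg h, if_neg h, mul_one]

variable (F E) in
/-- **The truncation as a monoid endomorphism of `J_E`.** [cite: Harari2020, Lemma 15.39 (proof)] -/
def truncMonoidHom : ideleGroup E →* ideleGroup E where
  toFun := truncOf S
  map_one' := truncOf_one S
  map_mul' := truncOf_mul S

omit [NumberField F] in
/-- Unfolding. [cite: Harari2020, Lemma 15.39 (proof)] -/
@[simp] theorem truncMonoidHom_apply (x : ideleGroup E) : truncMonoidHom F E S x = truncOf S x := rfl

omit [NumberField F] in
/-- **The truncation is the identity on `J_{E,S}`.** [cite: Harari2020, Lemma 15.39 (proof)] -/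
theorem truncOf_eq_self {x : ideleGroup E} (hx : x ∈ truncIdeles F E S) : truncOf S x = x := by
  apply Units.ext
  refine Prod.ext rfl (FiniteAdeleRing.ext E fun w => ?_)
  rw [truncOf_snd_apply]
  by_cases h : w.under (𝓞 F) ∈ S
  · rw [if_pos h]
  · rw [if_neg h, hx w h]

omit [NumberField F] in
/-- `(x^{(S)})^{(S)} = x^{(S)}`. [cite: Harari2020, Lemma 15.39 (proof)] -/
theorem truncOf_truncOf (x : ideleGroup E) : truncOf S (truncOf S x) = truncOf S x :=
  truncOf_eq_self S (truncOf_mem S x)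

/-- **`Gal(E/F)`-equivariance: `(σ • x)^{(S)} = σ • x^{(S)}`** (`σ` permutes the places above each `v`, so "above `S`"
is `σ`-invariant). [cite: Harari2020, §17.4 (17.1)] [cite: CasselsFrohlichANT1967, Ch. VII §1.1] -/
theorem truncOf_smul (σ : E ≃ₐ[F] E) (x : ideleGroup E) : truncOf S (σ • x) = σ • truncOf S x := by
  apply Units.ext
  refine Prod.ext ?_ (FiniteAdeleRing.ext E fun w => ?_)
  · rw [truncOf_fst, fst_smul, fst_smul, truncOf_fst]
  · rw [truncOf_snd_apply, snd_smul_apply, snd_smul_apply, truncOf_snd_apply, HeightOneSpectrum.under_algEquiv_smul]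
    by_cases h : w.under (𝓞 F) ∈ S
    · rw [if_pos h, if_pos h]
    · rw [if_neg h, if_neg h, map_one]

/-! ## §2. The splitting `ideleS = truncIdeles · unitIdelesOff` -/

omit [NumberField F] in
/-- **For a Tate `S`-idèle `x` (local units off `S`), `x · (x^{(S)})⁻¹ ∈ U_{E,S}`**: it is `1` at infinity and above `S`
and the local unit `x_w` off `S`. [cite: Harari2020, Lemma 15.39 (proof)] -/
theorem mul_truncOf_inv_mem_unitIdelesOff {x : ideleGroup E} (hx : x ∈ IdeleCohomology.ideleS F E S) :
    x * (truncOf S x)⁻¹ ∈ unitIdelesOff F E S := by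
  refine ⟨fun w => ?_, ?_, fun w hw => ?_⟩
  · rw [snd_mul_apply, truncOf_inv_snd_apply]
    by_cases h : w.under (𝓞 F) ∈ S
    · rw [if_pos h, ← snd_mul_apply, mul_inv_cancel]
      exact (congrArg Valued.v (show (((1 : ideleGroup E) : AdeleRing (𝓞 E) E).2 w) = 1 from rfl)).trans
        (map_one _)
    · rw [if_neg h, mul_one]; exact hx w h
  · rw [ideleGroup_val_fst_mul, truncOf_inv_fst, ← ideleGroup_val_fst_mul, mul_inv_cancel]; rfl
  · rw [snd_mul_apply, truncOf_inv_snd_apply, if_pos hw, ← snd_mul_apply, mul_inv_cancel]; rfl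

omit [NumberField F] in
/-- **`J_{E,S}^{Tate} = J_{E,S} · U_{E,S}`**: Tate's `S`-idèles are generated by Harari's truncated idèles and the unit
idèles off `S` (`x = (x (x^{(S)})⁻¹) · x^{(S)}`; with `truncIdeles_inf_unitIdelesOff` this is a direct product).
[cite: Harari2020, Lemma 15.39 (proof)] [cite: CasselsFrohlichANT1967, Ch. VII §7.3] -/
theorem truncIdeles_sup_unitIdelesOff : truncIdeles F E S ⊔ unitIdelesOff F E S = IdeleCohomology.ideleS F E S := by
  refine le_antisymm (sup_le truncIdeles_le_ideleS unitIdelesOff_le_ideleS) fun x hx => ?_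
  rw [← inv_mul_cancel_right x (truncOf S x)]
  exact Subgroup.mul_mem _ (Subgroup.mem_sup_right (mul_truncOf_inv_mem_unitIdelesOff S hx))
    (Subgroup.mem_sup_left (truncOf_mem S x))

omit [NumberField F] in
/-- **The truncation kills `U_{E,S}`**: `u^{(S)} = 1` for `u` trivial at infinity and above `S`.
[cite: Harari2020, Lemma 15.39 (proof)] -/
theorem truncOf_eq_one_of_mem_unitIdelesOff {u : ideleGroup E} (hu : u ∈ unitIdelesOff F E S) : truncOf S u = 1 := by
  apply Units.ext
  refine Prod.ext ?_ (FiniteAdeleRing.ext E fun w => ?_)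
  · rw [truncOf_fst, hu.2.1]; rfl
  · rw [truncOf_snd_apply]
    by_cases h : w.under (𝓞 F) ∈ S
    · rw [if_pos h, hu.2.2 w h]; rfl
    · rw [if_neg h]; rfl

/-! ## §3. `J_{E,S}` as a `Gal(E/F)`-module and the truncation as a morphism -/

variable (F E) in
/-- The `G`-action on `J_{E,S}` as a bare representation (`Herbrand.stableRepr` with `isStable_truncIdeles`).
[cite: Harari2020, Def. 17.22] -/
abbrev truncRepr : Representation ℤ (E ≃ₐ[F] E) (Additive (truncIdeles F E S)) :=
  Herbrand.stableRepr (MulDistribMulAction.toMulAut (E ≃ₐ[F] E) (ideleGroup E)) (truncIdeles F E S)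
    (fun σ _ hx => isStable_truncIdeles σ hx)

variable (F E) in
/-- **Harari's `J_{E,S}` as an object of `Rep ℤ Gal(E/F)`** ("we can view `J_F^T` as a `Gal(F/k)`-module").
[cite: Harari2020, Def. 17.22] -/
def truncRep : Rep ℤ (E ≃ₐ[F] E) := Rep.of (truncRepr F E S)

/-- The action unfolds to the Galois action on idèles. [cite: Harari2020, Def. 17.22] -/
theorem coe_toMul_truncRep_ρ (g : E ≃ₐ[F] E) (x : Additive (truncIdeles F E S)) :
    ((Additive.toMul ((truncRep F E S).ρ g x) : truncIdeles F E S) : ideleGroup E) =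
      g • ((Additive.toMul x : truncIdeles F E S) : ideleGroup E) := rfl

/-- The truncation `J_{E,S}^{Tate} → J_{E,S}` on underlying groups. [cite: Harari2020, Lemma 15.39 (proof)] -/
def truncSHom : IdeleCohomology.ideleS F E S →* truncIdeles F E S :=
  ((truncMonoidHom F E S).comp (IdeleCohomology.ideleS F E S).subtype).codRestrict _ fun x => truncOf_mem S x.1

omit [NumberField F] in
/-- Unfolding. [cite: Harari2020, Lemma 15.39 (proof)] -/
@[simp] theorem coe_truncSHom_apply (x : IdeleCohomology.ideleS F E S) :
    ((truncSHom S x : truncIdeles F E S) : ideleGroup E) = truncOf S (x : ideleGroup E) := rfl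

/-- **The truncation as a morphism `ideleSRep F E S ⟶ truncRep F E S` of `Rep ℤ Gal(E/F)`.**
[cite: Harari2020, §17.4 (17.1)] -/
def truncRepHom : IdeleCohomology.ideleSRep F E S ⟶ truncRep F E S :=
  Rep.ofHom ⟨(MonoidHom.toAdditive (truncSHom S)).toIntLinearMap, fun g => LinearMap.ext fun x => by
    apply Additive.toMul.injective
    apply Subtype.ext
    change truncOf S (g • ((Additive.toMul x : IdeleCohomology.ideleS F E S) : ideleGroup E)) =
      g • truncOf S ((Additive.toMul x : IdeleCohomology.ideleS F E S) : ideleGroup E)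
    exact truncOf_smul S g _⟩

/-- Unfolding: the morphism is the truncation on underlying idèles. [cite: Harari2020, §17.4 (17.1)] -/
theorem coe_toMul_truncRepHom_apply (x : (IdeleCohomology.ideleSRep F E S).V) :
    ((Additive.toMul ((truncRepHom S).hom x) : truncIdeles F E S) : ideleGroup E) =
      truncOf S ((Additive.toMul x : IdeleCohomology.ideleS F E S) : ideleGroup E) := rfl

end IdeleHerbrand

end Literature.NumberTheory.GaloisRepresentations

end
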